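import Summits.Ventures.YMGap.Thresholds.OneLinkCasimirTwo
import Summits.Ventures.YMGap.Thresholds.OneLinkRemainderWords
import HarnessLib

/-!
# Venture YMGap — the one-link modulus beyond first order, part 57: the RECENTRING Poisson algebra — Laplacian of the general
# degree-two combination and the exact Poisson solution of the MEAN PART of the cubic remainder (first foundation file of the
# mean-field recentring lever, cell note `HOME/p2/ONE-LINK-HIERARCHY.md` §16 (α) / `HOME/p2/hier/LEAN-SPEC-RECENTRING.md`)

HONEST FRAMING: venture file of the cell `pub-ymgap` (QuantumFields programme), strong-coupling LATTICE bookkeeping for `SU(N)`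
lattice Yang–Mills; nothing about the continuum or the mass gap in the Clay sense.  Pure matrix calculus, no measure, no number of
record.  WHAT.  With `λ = 2N − 4/N` and the tree's Casimir-2 system `Δ Re tr(QM₁QM₂) = −λ Re tr(QM₁QM₂) − 2 Re(tr(QM₁)tr(QM₂))`,
`Δ Re(tr(QM₁)tr(QM₂)) = −λ Re(tr(QM₁)tr(QM₂)) − 2 Re tr(QM₁QM₂)` (`OneLinkCasimirTwo`, also for imaginary parts by the `(−i)•` rotation):
* `reTrProd_negI_im`, `contDiff_imTrProd`, `Lap_imTrQuad`, `Lap_imTrProd`: the imaginary-part companions (`contDiff_imTrQuad` is the tree's, `OneLinkRemainderWords`);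
* `Lap_quadProd_comb`: `Δ(α₁ Re w + α₂ Im w + β₁ Re t + β₂ Im t) = (−λα₁−2β₁) Re w + (−λα₂−2β₂) Im w + (−2α₁−λβ₁) Re t + (−2α₂−λβ₂) Im t`
  (`w = tr(QM₁QM₂)`, `t = tr(QM₁)tr(QM₂)`, real coefficients) — so `ψ_w = −(λw − 2t)/(λ²−4)`, `ψ_t = −(λt − 2w)/(λ²−4)` solve `Δψ_w = w`,
  `Δψ_t = t` (`N ≥ 3`, `λ² > 4`);
* `Lap_deltaPsi` (THE RECENTRING POISSON IDENTITY): for arbitrary complex constants `m₁, m₂` (in the application: the means of `tr(gB)`,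
  `tr(gΔ)` under `ν_B`), the explicit quadratic function `δψ` built from `ψ_w, ψ_t` (words `(Δ,B)`) and `ψ_{BB}, ψ_{z₁²}` (words `(B,B)`)
  satisfies `Δ δψ = −N·c₃⁽ᵐ⁾`, where `c₃⁽ᵐ⁾` is the MEAN PART of the tree's cubic remainder `c₃ = Γ(Re tr(·B), ψ₂)`
  (`OneLinkRemainderIdentity.gam_potB_psiTwo_eq`: its four `z`-carrying terms with `tr(gB) ↦ m₁`, `tr(gΔ) ↦ m₂` in the `η`/`Im`-slots):
  `c₃⁽ᵐ⁾ = (2κ_w/N)·Im m₁·Im tr(gΔgB) − ½Re[tr(gBgB)(κ_t m₂ − conj m₂/(4N))] − ½Re[tr(gΔgB)(κ_t m₁ − conj m₁/(4N))] − (2κ_t/N)·Im m₁·Im(tr(gB)tr(gΔ))`.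
  Hence `N c₃⁽ᵐ⁾ = −Δδψ = −L_S δψ + N Γ(Re tr(·B), δψ)`: the mean part of the remainder is absorbed EXACTLY into the Poisson solution, and only
  the fluctuation `ẑ_j = z_j − m_j` is paid at the Bakry–Émery scale (next files).  Identity checked numerically on `SU(3)`, `SU(5)`
  (cell folder `HOME/p2/hier/recentre_check.py`, residual ≤ 5·10⁻⁹).
References: cell notes above; Shen–Zhu–Zhu CMP 400 (2023) §4 for the setting.
-/

noncomputable section

open scoped Matrix ComplexConjugate BigOperators ContDiff Matrix.Norms.Frobenius Topology
open Matrix Complex Finset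
open Literature.MathematicalPhysics.QuantumFieldTheory
open Literature.MathematicalPhysics.QuantumFieldTheory.SUNBakryEmery

namespace Summit.Ventures.YMGap.OneLinkEigen

variable {N : ℕ}

/-! ### Imaginary-part companions of the Casimir-2 system -/

/-- `Re(tr(QM₁)·tr(Q(−iM₂))) = Im(tr(QM₁)tr(QM₂))`. [folklore] -/
theorem reTrProd_negI_im (Q M₁ M₂ : Matrix (Fin N) (Fin N) ℂ) :
    ((Q * M₁).trace * (Q * ((-I) • M₂)).trace).re = ((Q * M₁).trace * (Q * M₂).trace).im := by
  rw [Matrix.mul_smul, trace_smul, smul_eq_mul, mul_re, mul_im, mul_re, mul_im, neg_re, neg_im, I_re, I_im]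
  ring

/-- `Q ↦ Im(tr(QM₁)tr(QM₂))` is smooth. [folklore] -/
theorem contDiff_imTrProd (M₁ M₂ : Matrix (Fin N) (Fin N) ℂ) :
    ContDiff ℝ ∞ fun Q : Matrix (Fin N) (Fin N) ℂ => ((Q * M₁).trace * (Q * M₂).trace).im := by
  have e : (fun Q : Matrix (Fin N) (Fin N) ℂ => ((Q * M₁).trace * (Q * M₂).trace).im) =
      fun Q => ((Q * M₁).trace * (Q * ((-I) • M₂)).trace).re := by
    funext Q; rw [reTrProd_negI_im]
  rw [e]; exact contDiff_reTrProd M₁ ((-I) • M₂)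

/-- **Casimir action on the imaginary part of the bilinear word**:
`Δ Im tr(QM₁QM₂) = −(2N − 4/N) Im tr(QM₁QM₂) − 2 Im(tr(QM₁)tr(QM₂))`. [folklore] -/
theorem Lap_imTrQuad (hN : N ≠ 0) (M₁ M₂ : Matrix (Fin N) (Fin N) ℂ) :
    Lap (fun Q : Matrix (Fin N) (Fin N) ℂ => (Q * M₁ * Q * M₂).trace.im) = fun Q =>
      -((2 * (N : ℝ) - 4 / N) * (Q * M₁ * Q * M₂).trace.im) - 2 * ((Q * M₁).trace * (Q * M₂).trace).im := by
  have e : (fun Q : Matrix (Fin N) (Fin N) ℂ => (Q * M₁ * Q * M₂).trace.im) =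
      fun Q => (Q * M₁ * Q * ((-I) • M₂)).trace.re := by
    funext Q; rw [re_trace_mul_negI_smul]
  rw [e, Lap_reTrQuad hN]
  funext Q
  rw [re_trace_mul_negI_smul, reTrProd_negI_im]

/-- **Casimir action on the imaginary part of the product**:
`Δ Im(tr(QM₁)tr(QM₂)) = −(2N − 4/N) Im(tr(QM₁)tr(QM₂)) − 2 Im tr(QM₁QM₂)`. [folklore] -/
theorem Lap_imTrProd (hN : N ≠ 0) (M₁ M₂ : Matrix (Fin N) (Fin N) ℂ) :
    Lap (fun Q : Matrix (Fin N) (Fin N) ℂ => ((Q * M₁).trace * (Q * M₂).trace).im) = fun Q =>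
      -((2 * (N : ℝ) - 4 / N) * ((Q * M₁).trace * (Q * M₂).trace).im) - 2 * (Q * M₁ * Q * M₂).trace.im := by
  have e : (fun Q : Matrix (Fin N) (Fin N) ℂ => ((Q * M₁).trace * (Q * M₂).trace).im) =
      fun Q => ((Q * M₁).trace * (Q * ((-I) • M₂)).trace).re := by
    funext Q; rw [reTrProd_negI_im]
  rw [e, Lap_reTrProd hN]
  funext Q
  rw [re_trace_mul_negI_smul, reTrProd_negI_im]

/-! ### The general degree-two combination and the Poisson solutions -/

/-- **Laplacian of the general real combination of the degree-two pair** `(w, t) = (tr(QM₁QM₂), tr(QM₁)tr(QM₂))`: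
`Δ(α₁ Re w + α₂ Im w + β₁ Re t + β₂ Im t) = (−λα₁−2β₁) Re w + (−λα₂−2β₂) Im w + (−2α₁−λβ₁) Re t + (−2α₂−λβ₂) Im t`, `λ = 2N − 4/N`. [folklore] -/
theorem Lap_quadProd_comb (hN : N ≠ 0) (M₁ M₂ : Matrix (Fin N) (Fin N) ℂ) (α₁ α₂ β₁ β₂ : ℝ) :
    Lap (fun Q : Matrix (Fin N) (Fin N) ℂ =>
        α₁ * (Q * M₁ * Q * M₂).trace.re + α₂ * (Q * M₁ * Q * M₂).trace.im
          + β₁ * ((Q * M₁).trace * (Q * M₂).trace).re + β₂ * ((Q * M₁).trace * (Q * M₂).trace).im) = fun Q =>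
      (-(2 * (N : ℝ) - 4 / N) * α₁ - 2 * β₁) * (Q * M₁ * Q * M₂).trace.re
        + (-(2 * (N : ℝ) - 4 / N) * α₂ - 2 * β₂) * (Q * M₁ * Q * M₂).trace.im
        + (-2 * α₁ - (2 * (N : ℝ) - 4 / N) * β₁) * ((Q * M₁).trace * (Q * M₂).trace).re
        + (-2 * α₂ - (2 * (N : ℝ) - 4 / N) * β₂) * ((Q * M₁).trace * (Q * M₂).trace).im := by
  have hdec : (fun Q : Matrix (Fin N) (Fin N) ℂ =>
        α₁ * (Q * M₁ * Q * M₂).trace.re + α₂ * (Q * M₁ * Q * M₂).trace.im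
          + β₁ * ((Q * M₁).trace * (Q * M₂).trace).re + β₂ * ((Q * M₁).trace * (Q * M₂).trace).im) =
      ((α₁ • fun Q : Matrix (Fin N) (Fin N) ℂ => (Q * M₁ * Q * M₂).trace.re)
        + α₂ • fun Q : Matrix (Fin N) (Fin N) ℂ => (Q * M₁ * Q * M₂).trace.im)
      + ((β₁ • fun Q : Matrix (Fin N) (Fin N) ℂ => ((Q * M₁).trace * (Q * M₂).trace).re)
        + β₂ • fun Q : Matrix (Fin N) (Fin N) ℂ => ((Q * M₁).trace * (Q * M₂).trace).im) := by
    funext Q; simp only [Pi.add_apply, Pi.smul_apply, smul_eq_mul]; ring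
  have h1 : ContDiff ℝ ∞ (α₁ • fun Q : Matrix (Fin N) (Fin N) ℂ => (Q * M₁ * Q * M₂).trace.re) := by
    have h := (contDiff_reTrQuad M₁ M₂).const_smul α₁; exact h
  have h2 : ContDiff ℝ ∞ (α₂ • fun Q : Matrix (Fin N) (Fin N) ℂ => (Q * M₁ * Q * M₂).trace.im) := by
    have h := (contDiff_imTrQuad M₁ M₂).const_smul α₂; exact h
  have h3 : ContDiff ℝ ∞ (β₁ • fun Q : Matrix (Fin N) (Fin N) ℂ => ((Q * M₁).trace * (Q * M₂).trace).re) := by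
    have h := (contDiff_reTrProd M₁ M₂).const_smul β₁; exact h
  have h4 : ContDiff ℝ ∞ (β₂ • fun Q : Matrix (Fin N) (Fin N) ℂ => ((Q * M₁).trace * (Q * M₂).trace).im) := by
    have h := (contDiff_imTrProd M₁ M₂).const_smul β₂; exact h
  have h12 : ContDiff ℝ ∞ ((α₁ • fun Q : Matrix (Fin N) (Fin N) ℂ => (Q * M₁ * Q * M₂).trace.re)
      + α₂ • fun Q : Matrix (Fin N) (Fin N) ℂ => (Q * M₁ * Q * M₂).trace.im) := h1.add h2
  have h34 : ContDiff ℝ ∞ ((β₁ • fun Q : Matrix (Fin N) (Fin N) ℂ => ((Q * M₁).trace * (Q * M₂).trace).re)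
      + β₂ • fun Q : Matrix (Fin N) (Fin N) ℂ => ((Q * M₁).trace * (Q * M₂).trace).im) := h3.add h4
  rw [hdec, Lap_add h12 h34, Lap_add h1 h2, Lap_add h3 h4,
    Lap_smul _ (contDiff_reTrQuad M₁ M₂), Lap_smul _ (contDiff_imTrQuad M₁ M₂),
    Lap_smul _ (contDiff_reTrProd M₁ M₂), Lap_smul _ (contDiff_imTrProd M₁ M₂),
    Lap_reTrQuad hN, Lap_imTrQuad hN, Lap_reTrProd hN, Lap_imTrProd hN]
  funext Q
  simp only [Pi.add_apply, Pi.smul_apply, smul_eq_mul]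
  ring

/-- `λ² − 4 > 0` for `N ≥ 3` (`λ = 2N − 4/N`). [folklore] -/
theorem casimirTwo_sq_sub_four_pos (hN : 3 ≤ N) : 0 < (2 * (N : ℝ) - 4 / N) ^ 2 - 4 := by
  have h3 : (3 : ℝ) ≤ N := by exact_mod_cast hN
  have hNpos : (0 : ℝ) < N := by linarith
  have h1 : 4 / (N : ℝ) ≤ 4 / 3 := div_le_div_of_nonneg_left (by norm_num) (by norm_num) h3
  nlinarith [h1, h3]

/-- **Poisson solution for the bilinear word**: `Δ ψ_w = Re w` with `ψ_w = −(λ Re w − 2 Re t)/(λ² − 4)` (`N ≥ 3`). [folklore] -/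
theorem Lap_poisson_reQuad (hN : 3 ≤ N) (M₁ M₂ : Matrix (Fin N) (Fin N) ℂ) :
    Lap (fun Q : Matrix (Fin N) (Fin N) ℂ =>
        -((2 * (N : ℝ) - 4 / N) / ((2 * (N : ℝ) - 4 / N) ^ 2 - 4)) * (Q * M₁ * Q * M₂).trace.re
          + (2 / ((2 * (N : ℝ) - 4 / N) ^ 2 - 4)) * ((Q * M₁).trace * (Q * M₂).trace).re) =
      fun Q => (Q * M₁ * Q * M₂).trace.re := by
  have hN0 : N ≠ 0 := by omega
  have hD := (casimirTwo_sq_sub_four_pos hN).ne'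
  have h := Lap_quadProd_comb hN0 M₁ M₂ (-((2 * (N : ℝ) - 4 / N) / ((2 * (N : ℝ) - 4 / N) ^ 2 - 4))) 0
    (2 / ((2 * (N : ℝ) - 4 / N) ^ 2 - 4)) 0
  have e : (fun Q : Matrix (Fin N) (Fin N) ℂ =>
        -((2 * (N : ℝ) - 4 / N) / ((2 * (N : ℝ) - 4 / N) ^ 2 - 4)) * (Q * M₁ * Q * M₂).trace.re
          + (2 / ((2 * (N : ℝ) - 4 / N) ^ 2 - 4)) * ((Q * M₁).trace * (Q * M₂).trace).re) =
      fun Q : Matrix (Fin N) (Fin N) ℂ =>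
        -((2 * (N : ℝ) - 4 / N) / ((2 * (N : ℝ) - 4 / N) ^ 2 - 4)) * (Q * M₁ * Q * M₂).trace.re
          + 0 * (Q * M₁ * Q * M₂).trace.im
          + (2 / ((2 * (N : ℝ) - 4 / N) ^ 2 - 4)) * ((Q * M₁).trace * (Q * M₂).trace).re
          + 0 * ((Q * M₁).trace * (Q * M₂).trace).im := by
    funext Q; ring
  rw [e, h]
  funext Q
  generalize hL : (2 * (N : ℝ) - 4 / N) = L at *
  have hD2 : L ^ 2 - 4 ≠ 0 := hD
  field_simp
  ring

/-- **Poisson solution for the product**: `Δ ψ_t = Re t` with `ψ_t = −(λ Re t − 2 Re w)/(λ² − 4)` (`N ≥ 3`). [folklore] -/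
theorem Lap_poisson_reProd (hN : 3 ≤ N) (M₁ M₂ : Matrix (Fin N) (Fin N) ℂ) :
    Lap (fun Q : Matrix (Fin N) (Fin N) ℂ =>
        (2 / ((2 * (N : ℝ) - 4 / N) ^ 2 - 4)) * (Q * M₁ * Q * M₂).trace.re
          - ((2 * (N : ℝ) - 4 / N) / ((2 * (N : ℝ) - 4 / N) ^ 2 - 4)) * ((Q * M₁).trace * (Q * M₂).trace).re) =
      fun Q => ((Q * M₁).trace * (Q * M₂).trace).re := by
  have hN0 : N ≠ 0 := by omega
  have hD := (casimirTwo_sq_sub_four_pos hN).ne'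
  have h := Lap_quadProd_comb hN0 M₁ M₂ (2 / ((2 * (N : ℝ) - 4 / N) ^ 2 - 4)) 0
    (-((2 * (N : ℝ) - 4 / N) / ((2 * (N : ℝ) - 4 / N) ^ 2 - 4))) 0
  have e : (fun Q : Matrix (Fin N) (Fin N) ℂ =>
        (2 / ((2 * (N : ℝ) - 4 / N) ^ 2 - 4)) * (Q * M₁ * Q * M₂).trace.re
          - ((2 * (N : ℝ) - 4 / N) / ((2 * (N : ℝ) - 4 / N) ^ 2 - 4)) * ((Q * M₁).trace * (Q * M₂).trace).re) =
      fun Q : Matrix (Fin N) (Fin N) ℂ =>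
        (2 / ((2 * (N : ℝ) - 4 / N) ^ 2 - 4)) * (Q * M₁ * Q * M₂).trace.re
          + 0 * (Q * M₁ * Q * M₂).trace.im
          + (-((2 * (N : ℝ) - 4 / N) / ((2 * (N : ℝ) - 4 / N) ^ 2 - 4))) * ((Q * M₁).trace * (Q * M₂).trace).re
          + 0 * ((Q * M₁).trace * (Q * M₂).trace).im := by
    funext Q; ring
  rw [e, h]
  funext Q
  generalize hL : (2 * (N : ℝ) - 4 / N) = L at *
  have hD2 : L ^ 2 - 4 ≠ 0 := hD
  field_simp
  ring

/-! ### The recentring Poisson identity -/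

/-- **THE RECENTRING POISSON IDENTITY.**  `N ≥ 3`, `λ = 2N − 4/N`, `D = λ² − 4`, `κ_w = N²/(4(N²−4))`, `κ_t = N/(2(N²−4))`,
`c = 1/(4N)`; for complex constants `m₁, m₂` put `e_j = κ_t m_j − c·conj m_j` (so `Re e_j = (κ_t − c) Re m_j`, `Im e_j = (κ_t + c) Im m_j`).
The quadratic function
`δψ = −2κ_w Im m₁·Im ψ_w + (N/2)Re[e₂ ψ_{BB}] + (N/2)Re[e₁ ψ_w] + 2κ_t Im m₁·Im ψ_t`,
`ψ_w = (−λ w + 2t)/D`, `ψ_t = (−λ t + 2w)/D` (`w = tr(QΔQB)`, `t = tr(QB)tr(QΔ)`), `ψ_{BB} = (−λ tr(QBQB) + 2 tr(QB)²)/D`, written below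
as an explicit real combination, satisfies `Δ δψ = −N·c₃⁽ᵐ⁾` with `c₃⁽ᵐ⁾` the mean part of the tree's cubic remainder (module docstring).
[folklore] -/
theorem Lap_deltaPsi (hN : 3 ≤ N) (B Δ : Matrix (Fin N) (Fin N) ℂ) (m₁ m₂ : ℂ) :
    Lap (fun Q : Matrix (Fin N) (Fin N) ℂ =>
        (-2 * ((N : ℝ) ^ 2 / (4 * ((N : ℝ) ^ 2 - 4))) * m₁.im) *
            ((-(2 * (N : ℝ) - 4 / N) * (Q * Δ * Q * B).trace.im + 2 * ((Q * B).trace * (Q * Δ).trace).im)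
              / ((2 * (N : ℝ) - 4 / N) ^ 2 - 4))
        + ((N : ℝ) / 2) *
            ((((N : ℝ) / (2 * ((N : ℝ) ^ 2 - 4))) - 1 / (4 * (N : ℝ))) * m₂.re *
                ((-(2 * (N : ℝ) - 4 / N) * (Q * B * Q * B).trace.re + 2 * ((Q * B).trace * (Q * B).trace).re)
                  / ((2 * (N : ℝ) - 4 / N) ^ 2 - 4))
              - (((N : ℝ) / (2 * ((N : ℝ) ^ 2 - 4))) + 1 / (4 * (N : ℝ))) * m₂.im *
                ((-(2 * (N : ℝ) - 4 / N) * (Q * B * Q * B).trace.im + 2 * ((Q * B).trace * (Q * B).trace).im)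
                  / ((2 * (N : ℝ) - 4 / N) ^ 2 - 4)))
        + ((N : ℝ) / 2) *
            ((((N : ℝ) / (2 * ((N : ℝ) ^ 2 - 4))) - 1 / (4 * (N : ℝ))) * m₁.re *
                ((-(2 * (N : ℝ) - 4 / N) * (Q * Δ * Q * B).trace.re + 2 * ((Q * B).trace * (Q * Δ).trace).re)
                  / ((2 * (N : ℝ) - 4 / N) ^ 2 - 4))
              - (((N : ℝ) / (2 * ((N : ℝ) ^ 2 - 4))) + 1 / (4 * (N : ℝ))) * m₁.im *
                ((-(2 * (N : ℝ) - 4 / N) * (Q * Δ * Q * B).trace.im + 2 * ((Q * B).trace * (Q * Δ).trace).im)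
                  / ((2 * (N : ℝ) - 4 / N) ^ 2 - 4)))
        + (2 * ((N : ℝ) / (2 * ((N : ℝ) ^ 2 - 4))) * m₁.im) *
            ((-(2 * (N : ℝ) - 4 / N) * ((Q * B).trace * (Q * Δ).trace).im + 2 * (Q * Δ * Q * B).trace.im)
              / ((2 * (N : ℝ) - 4 / N) ^ 2 - 4))) =
      fun Q : Matrix (Fin N) (Fin N) ℂ => -((N : ℝ) *
        (2 * ((N : ℝ) ^ 2 / (4 * ((N : ℝ) ^ 2 - 4))) / N * m₁.im * (Q * Δ * Q * B).trace.im
          - 1 / 2 * ((Q * B * Q * B).trace *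
              ((((N : ℝ) / (2 * ((N : ℝ) ^ 2 - 4)) : ℝ) : ℂ) * m₂ - ((1 / (4 * (N : ℝ)) : ℝ) : ℂ) * (starRingEnd ℂ) m₂)).re
          - 1 / 2 * ((Q * Δ * Q * B).trace *
              ((((N : ℝ) / (2 * ((N : ℝ) ^ 2 - 4)) : ℝ) : ℂ) * m₁ - ((1 / (4 * (N : ℝ)) : ℝ) : ℂ) * (starRingEnd ℂ) m₁)).re
          - 2 * ((N : ℝ) / (2 * ((N : ℝ) ^ 2 - 4))) / N * m₁.im * ((Q * B).trace * (Q * Δ).trace).im)) := by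
  have hN0 : N ≠ 0 := by omega
  have hNr : (N : ℝ) ≠ 0 := by exact_mod_cast hN0
  have hD := (casimirTwo_sq_sub_four_pos hN).ne'
  -- abbreviations for the scalars (kept as `obtain … rfl`-free real variables with their defining equations)
  obtain ⟨L, hL⟩ : ∃ L : ℝ, L = 2 * (N : ℝ) - 4 / N := ⟨_, rfl⟩
  obtain ⟨D, hDdef⟩ : ∃ D : ℝ, D = (2 * (N : ℝ) - 4 / N) ^ 2 - 4 := ⟨_, rfl⟩
  obtain ⟨kw, hkw⟩ : ∃ kw : ℝ, kw = (N : ℝ) ^ 2 / (4 * ((N : ℝ) ^ 2 - 4)) := ⟨_, rfl⟩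
  obtain ⟨kt, hkt⟩ : ∃ kt : ℝ, kt = (N : ℝ) / (2 * ((N : ℝ) ^ 2 - 4)) := ⟨_, rfl⟩
  obtain ⟨c, hc⟩ : ∃ c : ℝ, c = 1 / (4 * (N : ℝ)) := ⟨_, rfl⟩
  have hD' : D ≠ 0 := by rw [hDdef]; exact hD
  have hDL : D = L ^ 2 - 4 := by rw [hDdef, hL]
  -- the (Δ, B) block and the (B, B) block as instances of `Lap_quadProd_comb`
  -- coefficients of the (Δ,B) block
  obtain ⟨a1, ha1⟩ : ∃ a1 : ℝ, a1 = -((N : ℝ) / 2) * ((kt - c) * m₁.re) * L / D := ⟨_, rfl⟩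
  obtain ⟨a2, ha2⟩ : ∃ a2 : ℝ, a2 = 2 * kw * m₁.im * L / D + ((N : ℝ) / 2) * ((kt + c) * m₁.im) * L / D
      + 4 * kt * m₁.im / D := ⟨_, rfl⟩
  obtain ⟨b1, hb1⟩ : ∃ b1 : ℝ, b1 = (N : ℝ) * ((kt - c) * m₁.re) / D := ⟨_, rfl⟩
  obtain ⟨b2, hb2⟩ : ∃ b2 : ℝ, b2 = -(4 * kw * m₁.im) / D - (N : ℝ) * ((kt + c) * m₁.im) / D
      - 2 * kt * m₁.im * L / D := ⟨_, rfl⟩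
  -- coefficients of the (B,B) block
  obtain ⟨a1', ha1'⟩ : ∃ a1' : ℝ, a1' = -((N : ℝ) / 2) * ((kt - c) * m₂.re) * L / D := ⟨_, rfl⟩
  obtain ⟨a2', ha2'⟩ : ∃ a2' : ℝ, a2' = ((N : ℝ) / 2) * ((kt + c) * m₂.im) * L / D := ⟨_, rfl⟩
  obtain ⟨b1', hb1'⟩ : ∃ b1' : ℝ, b1' = (N : ℝ) * ((kt - c) * m₂.re) / D := ⟨_, rfl⟩
  obtain ⟨b2', hb2'⟩ : ∃ b2' : ℝ, b2' = -((N : ℝ) * ((kt + c) * m₂.im)) / D := ⟨_, rfl⟩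
  have hblock1 := Lap_quadProd_comb hN0 Δ B a1 a2 b1 b2
  have hblock2 := Lap_quadProd_comb hN0 B B a1' a2' b1' b2'
  have hc1 : ContDiff ℝ ∞ (fun Q : Matrix (Fin N) (Fin N) ℂ =>
        a1 * (Q * Δ * Q * B).trace.re + a2 * (Q * Δ * Q * B).trace.im
          + b1 * ((Q * Δ).trace * (Q * B).trace).re + b2 * ((Q * Δ).trace * (Q * B).trace).im) :=
    ((((contDiff_reTrQuad Δ B).const_smul a1).add ((contDiff_imTrQuad Δ B).const_smul a2)).add
      ((contDiff_reTrProd Δ B).const_smul b1)).add ((contDiff_imTrProd Δ B).const_smul b2)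
  have hc2 : ContDiff ℝ ∞ (fun Q : Matrix (Fin N) (Fin N) ℂ =>
        a1' * (Q * B * Q * B).trace.re + a2' * (Q * B * Q * B).trace.im
          + b1' * ((Q * B).trace * (Q * B).trace).re + b2' * ((Q * B).trace * (Q * B).trace).im) :=
    ((((contDiff_reTrQuad B B).const_smul a1').add ((contDiff_imTrQuad B B).const_smul a2')).add
      ((contDiff_reTrProd B B).const_smul b1')).add ((contDiff_imTrProd B B).const_smul b2')
  -- the commuted product `tr(QB)tr(QΔ) = tr(QΔ)tr(QB)`
  have ecomm : ∀ Q : Matrix (Fin N) (Fin N) ℂ, (Q * B).trace * (Q * Δ).trace = (Q * Δ).trace * (Q * B).trace :=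
    fun Q => mul_comm _ _
  -- rewrite `δψ` as block1 + block2
  have hdec : (fun Q : Matrix (Fin N) (Fin N) ℂ =>
        (-2 * ((N : ℝ) ^ 2 / (4 * ((N : ℝ) ^ 2 - 4))) * m₁.im) *
            ((-(2 * (N : ℝ) - 4 / N) * (Q * Δ * Q * B).trace.im + 2 * ((Q * B).trace * (Q * Δ).trace).im)
              / ((2 * (N : ℝ) - 4 / N) ^ 2 - 4))
        + ((N : ℝ) / 2) *
            ((((N : ℝ) / (2 * ((N : ℝ) ^ 2 - 4))) - 1 / (4 * (N : ℝ))) * m₂.re *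
                ((-(2 * (N : ℝ) - 4 / N) * (Q * B * Q * B).trace.re + 2 * ((Q * B).trace * (Q * B).trace).re)
                  / ((2 * (N : ℝ) - 4 / N) ^ 2 - 4))
              - (((N : ℝ) / (2 * ((N : ℝ) ^ 2 - 4))) + 1 / (4 * (N : ℝ))) * m₂.im *
                ((-(2 * (N : ℝ) - 4 / N) * (Q * B * Q * B).trace.im + 2 * ((Q * B).trace * (Q * B).trace).im)
                  / ((2 * (N : ℝ) - 4 / N) ^ 2 - 4)))
        + ((N : ℝ) / 2) *
            ((((N : ℝ) / (2 * ((N : ℝ) ^ 2 - 4))) - 1 / (4 * (N : ℝ))) * m₁.re *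
                ((-(2 * (N : ℝ) - 4 / N) * (Q * Δ * Q * B).trace.re + 2 * ((Q * B).trace * (Q * Δ).trace).re)
                  / ((2 * (N : ℝ) - 4 / N) ^ 2 - 4))
              - (((N : ℝ) / (2 * ((N : ℝ) ^ 2 - 4))) + 1 / (4 * (N : ℝ))) * m₁.im *
                ((-(2 * (N : ℝ) - 4 / N) * (Q * Δ * Q * B).trace.im + 2 * ((Q * B).trace * (Q * Δ).trace).im)
                  / ((2 * (N : ℝ) - 4 / N) ^ 2 - 4)))
        + (2 * ((N : ℝ) / (2 * ((N : ℝ) ^ 2 - 4))) * m₁.im) *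
            ((-(2 * (N : ℝ) - 4 / N) * ((Q * B).trace * (Q * Δ).trace).im + 2 * (Q * Δ * Q * B).trace.im)
              / ((2 * (N : ℝ) - 4 / N) ^ 2 - 4))) =
      (fun Q : Matrix (Fin N) (Fin N) ℂ =>
        a1 * (Q * Δ * Q * B).trace.re + a2 * (Q * Δ * Q * B).trace.im
          + b1 * ((Q * Δ).trace * (Q * B).trace).re + b2 * ((Q * Δ).trace * (Q * B).trace).im)
      + (fun Q : Matrix (Fin N) (Fin N) ℂ =>
        a1' * (Q * B * Q * B).trace.re + a2' * (Q * B * Q * B).trace.im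
          + b1' * ((Q * B).trace * (Q * B).trace).re + b2' * ((Q * B).trace * (Q * B).trace).im) := by
    funext Q
    simp only [Pi.add_apply]
    rw [← hDdef, ← hL, ← hkw, ← hkt, ← hc, ecomm Q, ha1, ha2, hb1, hb2, ha1', ha2', hb1', hb2']
    field_simp
    ring
  rw [hdec, Lap_add hc1 hc2, hblock1, hblock2]
  funext Q
  simp only [Pi.add_apply]
  rw [← hL, ← hkw, ecomm Q]
  simp only [mul_re, sub_re, sub_im, mul_im, ofReal_re, ofReal_im, conj_re, conj_im, zero_mul, sub_zero,
    add_zero]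
  rw [← hkt, ← hc, ha1, ha2, hb1, hb2, ha1', ha2', hb1', hb2', hDL]
  have hD2 : L ^ 2 - 4 ≠ 0 := by rw [← hDL]; exact hD'
  field_simp
  ring

end Summit.Ventures.YMGap.OneLinkEigen
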